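import Summits.BirchSwinnertonDyer.BirchSwinnertonDyer.Theorems.ByReductionTypeAtTwoOrdKatoHalfAtTwoIsoConjATwoCubicModelOfClassicalMu
import Summits.BirchSwinnertonDyer.BirchSwinnertonDyer.Theorems.ByReductionTypeAtTwoFineSelmerConjAAtTwoAdditivePotGoodTwoLayerStampsEvenIndexA
import HarnessLib

/-!
# KERNEL even-index STAMP at `2`: (A)₂ for `237952bv1` from ONE parity bit with NO Lim 2017 fact — the transfer door
# `ℚ(β) = ℚ(θ)` + the even-index certificate + the μ₂ ascent `ℚ(θ) → ℚ(E[2])` (crux `OrdKatoHalfAtTwoIso`, stmt-BirchSwinnertonDyer-19573)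

Written by the prover seat `cruxlead-stmt-BirchSwinnertonDyer-19573-w2` GEN 7 (`--supports` stmt-BirchSwinnertonDyer-19573; no item closed; BSD is NOT
proved here). Module (E-h):

* `conjA_two_cubicModel_of_evenIndexCertificate_adjoin_eq_of_discr_neg` — the EVEN-INDEX kernel row in the cell's STAMP shape: curve
  `y² = x³ + px² + qx + r` with `disc < 0`, `β` a root of its cubic, a nicer generator `θ` of the same field (`ℚ(β) = ℚ(θ)`, `θ` a root of an
  irreducible `X³ + p'X² + q'X + r'`), an even-index certificate `(u, v, m, m')` in `𝓞_{ℚ(θ)}`, `h(ℚ(θ))` odd and the layer-1 bit ⟹ (A)₂ —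
  i.e. `AddKatoTwo.fineSelmerDual_moduleFinite_two_of_evenIndexCertificate_pointField` WITHOUT `hLim2` (on `disc < 0`).
* **`conjA_two_237952bv1_of_layerOneBit_kernel`** — the census row `237952bv1` (`y² = x³ − 947226241x − 11222597935198`, point field `ℚ(θ)`,
  `θ³ − θ − 2 = 0`, `d = −104`, `2 = 𝔭²𝔮`): k4's `conjA_two_237952bv1_of_layerOneBit` with the named fact `hLim2` REMOVED; the ONLY remaining
  hypothesis is the displayed census bit «`e₁ = 0` along the cyclotomic `ℤ₂`-extensions of `ℚ(θ)`» (`2 ∤ h(ℚ(θ, √2))`).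

References: [Iwasawa1973MuInvariants] Thm. 2/3; [Fukuda1994] Thm. 1; [CoatesSujatha2005] §3; [Cohen1993] App. B.
-/

set_option autoImplicit false

noncomputable section

open scoped NumberField Polynomial
open NumberField Field Polynomial

namespace Summit.BirchSwinnertonDyer.BirchSwinnertonDyer.Theorems.SteinbergFibreAtTwo.TotallyComplexMu

open Literature.NumberTheory.EllipticCurves Literature.NumberTheory.EllipticCurves.ZpExtension
  Literature.NumberTheory.GaloisRepresentations Literature.NumberTheory.IwasawaTheory
  Summit.BirchSwinnertonDyer.BirchSwinnertonDyer.Theorems.AddKatoTwo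

/-- A monic rational cubic with a root `β` generating a CUBIC field is irreducible. [folklore] -/
private theorem irreducible_cubic_of_finrank_eq_three {p q r : ℤ} {β : AlgebraicClosure ℚ}
    (hβ : aeval β (Cubic.toPoly ⟨1, (p : ℚ), q, r⟩) = 0)
    (h3 : Module.finrank ℚ ↥(IntermediateField.adjoin ℚ ({β} : Set (AlgebraicClosure ℚ))) = 3) :
    Irreducible (Cubic.toPoly ⟨1, (p : ℚ), q, r⟩) := by
  have hmonic : (Cubic.toPoly ⟨1, (p : ℚ), q, r⟩).Monic := Cubic.monic_of_a_eq_one rfl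
  have hβint : IsIntegral ℚ β := ⟨_, hmonic, by rwa [← aeval_def]⟩
  have hdeg : (minpoly ℚ β).natDegree = 3 := by rw [← IntermediateField.adjoin.finrank hβint, h3]
  have heq : Cubic.toPoly ⟨1, (p : ℚ), q, r⟩ = minpoly ℚ β :=
    eq_of_monic_of_dvd_of_natDegree_le (minpoly.monic hβint) hmonic (minpoly.dvd ℚ β hβ)
      (by rw [hdeg]; exact (Cubic.natDegree_of_a_ne_zero' one_ne_zero).le)
  rw [heq]; exact minpoly.irreducible hβint

/-- **KERNEL EVEN-INDEX row in STAMP shape** (`AddKatoTwo.fineSelmerDual_moduleFinite_two_of_evenIndexCertificate_pointField` without `hLim2`, on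
`disc < 0`): curve `y² = x³ + px² + qx + r` (`disc < 0`, `β` a root of the cubic), `ℚ(β) = ℚ(θ)` with `θ` a root of an irreducible
`X³ + p'X² + q'X + r'`, an even-index certificate `(u, v, m, m')` in `𝓞_{ℚ(θ)}` (`u² − 2v² = 4m`, `m² = 2m'`, `8 ∤ N(2 − m'³)`), `h(ℚ(θ))` odd and
the layer-1 certificate ⟹ statement (A) at `2` (`∃ γ D` kernel form). [cite: Iwasawa1973MuInvariants, Thm. 2 and Thm. 3] [cite: Fukuda1994, Thm. 1]
[cite: CoatesSujatha2005, §3 Thm. 3.4 and Cor. 3.6] -/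
theorem conjA_two_cubicModel_of_evenIndexCertificate_adjoin_eq_of_discr_neg (p q r : ℤ)
    [((⟨0, (p : ℚ), 0, (q : ℚ), (r : ℚ)⟩ : WeierstrassCurve ℚ)).IsElliptic]
    (hd : Cubic.discr ⟨1, (p : ℚ), q, r⟩ < 0)
    {β : AlgebraicClosure ℚ} (hβ : aeval β (Cubic.toPoly ⟨1, (p : ℚ), q, r⟩) = 0)
    {p' q' r' : ℤ} (hirr' : Irreducible (Cubic.toPoly ⟨1, (p' : ℚ), q', r'⟩))
    {θ : AlgebraicClosure ℚ} (hθ : aeval θ (Cubic.toPoly ⟨1, (p' : ℚ), q', r'⟩) = 0)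
    (hadj : IntermediateField.adjoin ℚ ({β} : Set (AlgebraicClosure ℚ)) = IntermediateField.adjoin ℚ ({θ} : Set (AlgebraicClosure ℚ)))
    (u v m m' : 𝓞 ↥(IntermediateField.adjoin ℚ ({θ} : Set (AlgebraicClosure ℚ)))) (huv : u ^ 2 - 2 * v ^ 2 = 4 * m) (hm : m ^ 2 = 2 * m')
    (hN : ¬ (8 : ℤ) ∣ Algebra.norm ℤ (2 - m' ^ 3))
    (hh : ¬ 2 ∣ Nat.card (ClassGroup (𝓞 ↥(IntermediateField.adjoin ℚ ({θ} : Set (AlgebraicClosure ℚ))))))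
    (h1 : haveI : FiniteDimensional ℚ ↥(IntermediateField.adjoin ℚ ({θ} : Set (AlgebraicClosure ℚ))) :=
        IntermediateField.adjoin.finiteDimensional ((AlgebraicClosure.isAlgebraic ℚ).isAlgebraic θ).isIntegral
      haveI : NumberField ↥(IntermediateField.adjoin ℚ ({θ} : Set (AlgebraicClosure ℚ))) := NumberField.mk
      ∀ κL : ZpExtension ↥(IntermediateField.adjoin ℚ ({θ} : Set (AlgebraicClosure ℚ))) 2, κL.IsCyclotomic → classNumberPExp κL 1 = 0)
    (κ : ZpExtension ℚ 2) (hκ : κ.IsCyclotomic) :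
    ∃ (γ : absoluteGaloisGroup ℚ) (D : ((⟨0, (p : ℚ), 0, (q : ℚ), (r : ℚ)⟩ : WeierstrassCurve ℚ)).FineSelmerDualData κ γ),
      Module.Finite ℤ_[2] (RestrictScalars ℤ_[2] (IwasawaAlgebra 2) D.X) := by
  have h3θ := finrank_adjoin_eq_three_of_irreducible hirr' hθ
  have h3β : Module.finrank ℚ ↥(IntermediateField.adjoin ℚ ({β} : Set (AlgebraicClosure ℚ))) = 3 := by rw [hadj]; exact h3θ
  have hirr := irreducible_cubic_of_finrank_eq_three hβ h3β
  have hμθ : ∀ κP : ZpExtension ↥(IntermediateField.adjoin ℚ ({θ} : Set (AlgebraicClosure ℚ))) 2,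
      κP.IsCyclotomic → ClassicalMuVanishes κP := fun κP hκP ↦
    classicalMuVanishes_two_adjoin_of_evenIndexCertificate hirr' hθ u v m m' huv hm hN hh κP hκP (h1 κP hκP)
  have hμβ : ∀ κP : ZpExtension ↥(IntermediateField.adjoin ℚ ({β} : Set (AlgebraicClosure ℚ))) 2,
      κP.IsCyclotomic → ClassicalMuVanishes κP := by
    rw [hadj]; exact hμθ
  exact conjA_two_cubicModel_of_classicalMu_of_discr_neg p q r hirr hd hβ hμβ κ hκ

/-- **(A)₂ for `237952bv1` from ONE parity bit — KERNEL, no Lim 2017 fact** (k4's `conjA_two_237952bv1_of_layerOneBit` with `hLim2` removed):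
`y² = x³ − 947226241x − 11222597935198`, point field `ℚ(θ)`, `θ³ − θ − 2 = 0` (`d = −104 < 0`, `2 = 𝔭²𝔮`, `h = 1`); displayed: «`e₁ = 0` along the
cyclotomic `ℤ₂`-extensions of `ℚ(θ)`» (`2 ∤ h(ℚ(θ, √2))`, census `cyc6 = []`). KERNEL: `ℚ(P) = ℚ(β) = ℚ(θ)` with `β = −6032 + 13559θ + 9048θ²`;
the even-index certificate of the A-stamp file; Fukuda's Thm. 1; μ₂ ascent `ℚ(θ) → ℚ(E[2])` (`Δ < 0`). [cite: Fukuda1994, Thm. 1 (1), p. 264]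
[cite: Iwasawa1973MuInvariants, Thm. 2 and Thm. 3] [cite: Cohen1993, App. B (d = −104)] -/
theorem conjA_two_237952bv1_of_layerOneBit_kernel
    {θ : AlgebraicClosure ℚ} (hθ : aeval θ (Cubic.toPoly ⟨1, ((0 : ℤ) : ℚ), ((-1 : ℤ) : ℚ), ((-2 : ℤ) : ℚ)⟩) = 0)
    (h1 : haveI : FiniteDimensional ℚ ↥(IntermediateField.adjoin ℚ ({θ} : Set (AlgebraicClosure ℚ))) :=
        IntermediateField.adjoin.finiteDimensional ((AlgebraicClosure.isAlgebraic ℚ).isAlgebraic θ).isIntegral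
      haveI : NumberField ↥(IntermediateField.adjoin ℚ ({θ} : Set (AlgebraicClosure ℚ))) := NumberField.mk
      ∀ κL : ZpExtension ↥(IntermediateField.adjoin ℚ ({θ} : Set (AlgebraicClosure ℚ))) 2, κL.IsCyclotomic → classNumberPExp κL 1 = 0)
    (κ : ZpExtension ℚ 2) (hκ : κ.IsCyclotomic) :
    haveI := isElliptic_237952bv1'
    ∃ (γ : absoluteGaloisGroup ℚ) (D : (⟨0, ((0 : ℤ) : ℚ), 0, ((-947226241 : ℤ) : ℚ), ((-11222597935198 : ℤ) : ℚ)⟩ :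
        WeierstrassCurve ℚ).FineSelmerDualData κ γ),
      Module.Finite ℤ_[2] (RestrictScalars ℤ_[2] (IwasawaAlgebra 2) D.X) := by
  haveI := isElliptic_237952bv1'
  have hθ' : θ ^ 3 + (0 : AlgebraicClosure ℚ) * θ ^ 2 + (-1 : AlgebraicClosure ℚ) * θ + (-2 : AlgebraicClosure ℚ) = 0 := by
    have := hθ
    simp only [Cubic.toPoly, map_one, one_mul, aeval_add, aeval_mul, aeval_C, aeval_X_pow, aeval_X,
      eq_ratCast, Rat.cast_intCast] at this
    push_cast at this
    linear_combination this
  set β : AlgebraicClosure ℚ := algebraMap ℚ (AlgebraicClosure ℚ) (-6032 : ℚ) +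
      algebraMap ℚ (AlgebraicClosure ℚ) (13559 : ℚ) * θ + algebraMap ℚ (AlgebraicClosure ℚ) (9048 : ℚ) * θ ^ 2 with hβdef
  have hβ : aeval β (Cubic.toPoly ⟨1, ((0 : ℤ) : ℚ), ((-947226241 : ℤ) : ℚ), ((-11222597935198 : ℤ) : ℚ)⟩) = 0 := by
    simp only [Cubic.toPoly, map_one, one_mul, aeval_add, aeval_mul, aeval_C, aeval_X_pow, aeval_X, eq_ratCast,
      Rat.cast_intCast]
    rw [hβdef]
    simp only [eq_ratCast]
    push_cast
    linear_combination ((2864201857127 : AlgebraicClosure ℚ) + (4249602561672 : AlgebraicClosure ℚ) * θ +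
      (3330075647808 : AlgebraicClosure ℚ) * θ ^ 2 + (740726318592 : AlgebraicClosure ℚ) * θ ^ 3) * hθ'
  have hadj : IntermediateField.adjoin ℚ ({β} : Set (AlgebraicClosure ℚ)) = IntermediateField.adjoin ℚ {θ} := by
    apply le_antisymm
    · rw [IntermediateField.adjoin_simple_le_iff, hβdef]
      have hθmem := IntermediateField.mem_adjoin_simple_self ℚ θ
      exact add_mem (add_mem (algebraMap_mem _ _) (mul_mem (algebraMap_mem _ _) hθmem))
        (mul_mem (algebraMap_mem _ _) (pow_mem hθmem 2))
    · rw [IntermediateField.adjoin_simple_le_iff]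
      have hθeq : θ = algebraMap ℚ (AlgebraicClosure ℚ) (-2600668496/44926453 : ℚ) +
          algebraMap ℚ (AlgebraicClosure ℚ) (-926377/584043889 : ℚ) * β +
          algebraMap ℚ (AlgebraicClosure ℚ) (696/7592570557 : ℚ) * β ^ 2 := by
        rw [hβdef]; simp only [eq_ratCast]; push_cast
        linear_combination (((-1010491776 : AlgebraicClosure ℚ) / 44926453) +
          ((-337153536 : AlgebraicClosure ℚ) / 44926453) * θ) * hθ'
      rw [hθeq]
      have hβmem := IntermediateField.mem_adjoin_simple_self ℚ β
      exact add_mem (add_mem (algebraMap_mem _ _) (mul_mem (algebraMap_mem _ _) hβmem))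
        (mul_mem (algebraMap_mem _ _) (pow_mem hβmem 2))
  -- the even-index certificate in `𝓞 ℚ(θ)` (as in the A-stamp file)
  have hirr := irreducible_cubic_d104n
  haveI : FiniteDimensional ℚ ↥(IntermediateField.adjoin ℚ ({θ} : Set (AlgebraicClosure ℚ))) :=
    IntermediateField.adjoin.finiteDimensional ((AlgebraicClosure.isAlgebraic ℚ).isAlgebraic θ).isIntegral
  haveI : NumberField ↥(IntermediateField.adjoin ℚ ({θ} : Set (AlgebraicClosure ℚ))) := NumberField.mk
  obtain ⟨B, -, hB⟩ := exists_ringOfIntegers_cubic_root (p := 0) (q := -1) (r := -2) hθ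
  have h3 := finrank_adjoin_eq_three_of_irreducible hirr hθ
  refine conjA_two_cubicModel_of_evenIndexCertificate_adjoin_eq_of_discr_neg 0 (-947226241) (-11222597935198)
    (by simp only [Cubic.discr]; norm_num) hβ hirr hθ hadj
    (((-2 : ℤ) : 𝓞 (IntermediateField.adjoin ℚ {θ})) + ((-1 : ℤ) : 𝓞 (IntermediateField.adjoin ℚ {θ})) * B +
      ((-1 : ℤ) : 𝓞 (IntermediateField.adjoin ℚ {θ})) * B ^ 2)
    (((0 : ℤ) : 𝓞 (IntermediateField.adjoin ℚ {θ})) + ((0 : ℤ) : 𝓞 (IntermediateField.adjoin ℚ {θ})) * B +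
      ((-1 : ℤ) : 𝓞 (IntermediateField.adjoin ℚ {θ})) * B ^ 2)
    (((2 : ℤ) : 𝓞 (IntermediateField.adjoin ℚ {θ})) + ((1 : ℤ) : 𝓞 (IntermediateField.adjoin ℚ {θ})) * B +
      ((1 : ℤ) : 𝓞 (IntermediateField.adjoin ℚ {θ})) * B ^ 2)
    (((4 : ℤ) : 𝓞 (IntermediateField.adjoin ℚ {θ})) + ((4 : ℤ) : 𝓞 (IntermediateField.adjoin ℚ {θ})) * B +
      ((3 : ℤ) : 𝓞 (IntermediateField.adjoin ℚ {θ})) * B ^ 2) ?_ ?_ ?_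
    (by rw [card_classGroup_adjoin_eq_one_disc_neg104 hθ]; norm_num) h1 κ hκ
  · push_cast
    linear_combination (((2 : ℤ) : 𝓞 (IntermediateField.adjoin ℚ {θ})) + ((-1 : ℤ) : 𝓞 (IntermediateField.adjoin ℚ {θ})) * B) * hB
  · push_cast
    linear_combination (((2 : ℤ) : 𝓞 (IntermediateField.adjoin ℚ {θ})) + ((1 : ℤ) : 𝓞 (IntermediateField.adjoin ℚ {θ})) * B) * hB
  · have hz : (2 : 𝓞 (IntermediateField.adjoin ℚ {θ})) - (((4 : ℤ) : 𝓞 (IntermediateField.adjoin ℚ {θ})) +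
        ((4 : ℤ) : 𝓞 (IntermediateField.adjoin ℚ {θ})) * B + ((3 : ℤ) : 𝓞 (IntermediateField.adjoin ℚ {θ})) * B ^ 2) ^ 3 =
        ((-1090 : ℤ) : 𝓞 (IntermediateField.adjoin ℚ {θ})) + (-1264 : ℤ) * B + (-831 : ℤ) * B ^ 2 := by
      push_cast
      linear_combination (((-514 : ℤ) : 𝓞 (IntermediateField.adjoin ℚ {θ})) +
        ((-279 : ℤ) : 𝓞 (IntermediateField.adjoin ℚ {θ})) * B + ((-108 : ℤ) : 𝓞 (IntermediateField.adjoin ℚ {θ})) * B ^ 2 +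
        ((-27 : ℤ) : 𝓞 (IntermediateField.adjoin ℚ {θ})) * B ^ 3) * hB
    rw [hz]
    exact not_eight_dvd_norm_coords _ h3 B hirr hB (-1090) (-1264) (-831) (N := -24734)
      (by simp only [Matrix.one_fin_three, Matrix.det_fin_three, Matrix.add_apply, Matrix.smul_apply, sq, Matrix.mul_apply,
        Fin.sum_univ_three, Matrix.of_apply, Matrix.cons_val', Matrix.cons_val_zero, Matrix.cons_val_one, Matrix.cons_val_two,
        Matrix.head_cons, Matrix.tail_cons, Matrix.empty_val', Matrix.cons_val_fin_one, smul_eq_mul]; norm_num) (by norm_num)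

end Summit.BirchSwinnertonDyer.BirchSwinnertonDyer.Theorems.SteinbergFibreAtTwo.TotallyComplexMu

end
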